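import Mathlib
import HarnessLib
import Summits.HubbardSuperconductivity.HubbardSuperconductivity.Theorems.KLProgrammeKLRegimeWickConservation
import Summits.HubbardSuperconductivity.HubbardSuperconductivity.Theorems.KLProgrammeKLRegimeWickBubbleChannels
import Literature.MathematicalPhysics.QuantumLattice.FejerTopCutoff

/-!
# Route `KLProgramme` — ENGINE child (gen-6 `KLRegimeEngineV15`), stub `stub_engine_step_values`, (E2): the selection rules of the three-channel
# reading for an ARBITRARY SCALING-INVARIANT even element `W` (E2-WICK-ROADMAP §5 (iii-f); cell gate-hubbard-kl, seat p1 g9; k3c1-p1 g6's ask l.2175)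

The channel identities of p500935/p502214/p503245/p505192 are keyed on the grid carrier `𝒲_n = klWickAction … n`; the continuous organisation
(k3c1-p1, `…WickScaleFlow*`) reads them at the real-cutoff carrier `W_Λ`.  Both are EVEN elements of `HubbardGrassmann L M` invariant under every
non-zero vertex-compatible charge scaling `ψ̂^±_{kσ} ↦ φ(k,σ)^{±1}ψ̂^±_{kσ}` (`map_scaling_klWickAction`; at real `Λ` the same proof).  This file
re-keys the SELECTION RULES on that hypothesis alone (namespace `…Theorems.KLRegimeWickAbs`, same lemma names as the `klWickAction` versions):
§1 the four conservation laws (`kernel_eq_zero_of_charge/_freq/_spin/_momentum`) for any `W` with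
`hW : ∀ φ, (∀ p, φ p ≠ 0) → (vertex-compatible φ) → S_φ W = W`; §2 the leg-string selection rules used by the particle–particle,
particle–hole and two-leg readings (`kernel_pp_minus_left/right`, `kernel_pp_eq_zero_of_ne_partner`, `kernel_pp_eq_zero_of_spin_eq`,
`kernel_ph_same_charge`, `kernel_phd_eq_zero_of_ne`, `kernel_phx_eq_zero_of_not`, `kernel_two_plus/minus_eq_zero`); §3 the instance
`klWickAction_scalingInvariant` (so the abstract lemmas specialise back to p1 g8/g9's).  Proved; no definitions.
-/

noncomputable section

namespace Summit.HubbardSuperconductivity.HubbardSuperconductivity.Theorems.KLRegimeWickAbs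

set_option linter.dupNamespace false -- summit = problem name (single-conjunct summit), D-0017

open Literature.MathematicalPhysics.QuantumLattice GrassmannAlgebra Finset Matrix
open Literature.Probability.LatticeModels
open Summit.HubbardSuperconductivity.HubbardSuperconductivity.Theorems.TwoPointAssembly
open Summit.HubbardSuperconductivity.HubbardSuperconductivity.Theorems.KLProgrammeLegKernels
open Summit.HubbardSuperconductivity.HubbardSuperconductivity.Theorems.KLRegimeSplit
open Summit.HubbardSuperconductivity.HubbardSuperconductivity.Theorems.KLRegimeWick

section Model

variable {L M : ℕ} {W : HubbardGrassmann L M}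
  (hW : ∀ φ : FreqMomentum L M × Fin 2 → ℂ, (∀ p, φ p ≠ 0) →
    (∀ k₁ k₂ k₃ k₄ : FreqMomentum L M,
      matsubaraInt M k₁.1 + matsubaraInt M k₃.1 = matsubaraInt M k₂.1 + matsubaraInt M k₄.1 ∧ k₁.2 + k₃.2 = k₂.2 + k₄.2 →
        φ (k₁, 0) * φ (k₃, 1) = φ (k₂, 0) * φ (k₄, 1)) →
    ExteriorAlgebra.map (LinearMap.mulLeft ℂ (scalingWeight φ)) W = W)
include hW

/-! ## §1 The four conservation laws for a scaling-invariant `W` -/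

/-- **Selection rule**: under a non-zero vertex-compatible weight, the degree-`m` kernel of `W` vanishes on every label string of total weight `≠ 1`. -/
theorem kernel_eq_zero_of_weight_ne (φ : FreqMomentum L M × Fin 2 → ℂ) (hφ : ∀ p, φ p ≠ 0)
    (hV : ∀ k₁ k₂ k₃ k₄ : FreqMomentum L M,
      matsubaraInt M k₁.1 + matsubaraInt M k₃.1 = matsubaraInt M k₂.1 + matsubaraInt M k₄.1 ∧ k₁.2 + k₃.2 = k₂.2 + k₄.2 →
        φ (k₁, 0) * φ (k₃, 1) = φ (k₂, 0) * φ (k₄, 1))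
    {m : ℕ} {X : Fin m → HubbardFieldIdx L M} (hw : ∏ i, scalingWeight φ (X i) ≠ 1) : kernel ℂ W m X = 0 :=
  kernel_eq_zero_of_invariant ℂ (scalingWeight φ) (hW φ hφ hV) hw

/-- Selection rule for weights `2^{g}` with vertex-additive `g`. -/
theorem kernel_eq_zero_of_twoPow (g : FreqMomentum L M × Fin 2 → ℤ)
    (hg : ∀ k₁ k₂ k₃ k₄ : FreqMomentum L M,
      matsubaraInt M k₁.1 + matsubaraInt M k₃.1 = matsubaraInt M k₂.1 + matsubaraInt M k₄.1 ∧ k₁.2 + k₃.2 = k₂.2 + k₄.2 →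
        g (k₁, 0) + g (k₃, 1) = g (k₂, 0) + g (k₄, 1))
    {m : ℕ} {X : Fin m → HubbardFieldIdx L M} (hX : ∑ i, (if (X i).2 = 0 then (1 : ℤ) else -1) * g (X i).1 ≠ 0) :
    kernel ℂ W m X = 0 := by
  refine kernel_eq_zero_of_weight_ne hW (fun p => (2 : ℂ) ^ g p) (fun p => zpow_ne_zero _ two_ne_zero) (twoPow_compatible g hg) ?_
  rw [prod_scalingWeight_two_zpow]
  intro h
  exact hX (two_zpow_injective (h.trans (zpow_zero (2 : ℂ)).symm))

/-- **CHARGE conservation** for `W`. -/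
theorem kernel_eq_zero_of_charge {m : ℕ} {X : Fin m → HubbardFieldIdx L M} (hX : ∑ i, (if (X i).2 = 0 then (1 : ℤ) else -1) ≠ 0) :
    kernel ℂ W m X = 0 :=
  kernel_eq_zero_of_twoPow hW (fun _ => 1) (fun _ _ _ _ _ => rfl) (by simpa using hX)

/-- **FREQUENCY conservation** for `W`. -/
theorem kernel_eq_zero_of_freq {m : ℕ} {X : Fin m → HubbardFieldIdx L M}
    (hX : ∑ i, (if (X i).2 = 0 then (1 : ℤ) else -1) * matsubaraInt M (X i).1.1.1 ≠ 0) : kernel ℂ W m X = 0 :=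
  kernel_eq_zero_of_twoPow hW (fun p => matsubaraInt M p.1.1) (fun _ _ _ _ h => h.1) hX

/-- **SPIN conservation** for `W`. -/
theorem kernel_eq_zero_of_spin {m : ℕ} {X : Fin m → HubbardFieldIdx L M}
    (hX : ∑ i, (if (X i).2 = 0 then (1 : ℤ) else -1) * (if (X i).1.2 = 0 then 1 else 0) ≠ 0) : kernel ℂ W m X = 0 :=
  kernel_eq_zero_of_twoPow hW (fun p => if p.2 = 0 then 1 else 0) (fun _ _ _ _ _ => by simp) hX

/-! ## §2 Selection rules at the leg strings of the three channels and of the two-leg vertex -/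

/-- With two incoming legs `ψ̂⁻ψ̂⁻`, a `ψ̂⁻` line end in the first slot kills the kernel. -/
theorem kernel_pp_minus_left (p : FreqMomentum L M) (σ : Fin 2) (X' : HubbardFieldIdx L M) (A B : FreqMomentum L M × Fin 2) :
    kernel ℂ W 4 ![((p, σ), 1), X', (A, 1), (B, 1)] = 0 := by
  rcases X' with ⟨q, c⟩
  refine kernel_eq_zero_of_charge hW ?_
  fin_cases c <;> simp [Fin.sum_univ_four]

/-- … and in the second slot. -/
theorem kernel_pp_minus_right (X : HubbardFieldIdx L M) (p' : FreqMomentum L M) (σ' : Fin 2) (A B : FreqMomentum L M × Fin 2) :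
    kernel ℂ W 4 ![X, ((p', σ'), 1), (A, 1), (B, 1)] = 0 := by
  rcases X with ⟨q, c⟩
  refine kernel_eq_zero_of_charge hW ?_
  fin_cases c <;> simp [Fin.sum_univ_four]

/-- With the incoming pair `(↓, ↑)` the outgoing line ends carry opposite spins. -/
theorem kernel_pp_eq_zero_of_spin_eq (Q k : TorusSite 2 L) (ω : MatsubaraIdx M) (p p' : FreqMomentum L M) (σ : Fin 2) :
    kernel ℂ W 4 ![((p, σ), 0), ((p', σ), 0), (((ω.rev, Q - k), 1), 1), (((ω, k), 0), 1)] = 0 := by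
  refine kernel_eq_zero_of_spin hW ?_
  fin_cases σ <;> simp [Fin.sum_univ_four]

/-- At a particle–hole vertex (external legs `ψ̂⁺, ψ̂⁻`) two line ends of EQUAL charge kill the kernel. -/
theorem kernel_ph_same_charge (p p' : FreqMomentum L M) (σ σ' c : Fin 2) (A B : FreqMomentum L M × Fin 2) :
    kernel ℂ W 4 ![((p, σ), c), ((p', σ'), c), (A, 0), (B, 1)] = 0 := by
  refine kernel_eq_zero_of_charge hW ?_
  fin_cases c <;> simp [Fin.sum_univ_four]

variable [NeZero L]

/-- **MOMENTUM conservation** for `W`, coordinate by coordinate. -/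
theorem kernel_eq_zero_of_momentum {m : ℕ} {X : Fin m → HubbardFieldIdx L M} (j : Fin 2)
    (hX : ∑ i, (if (X i).2 = 0 then (1 : ℤ) else -1) • (X i).1.1.2 j ≠ 0) : kernel ℂ W m X = 0 := by
  refine kernel_eq_zero_of_weight_ne hW (fun p => (ZMod.stdAddChar (p.1.2 j) : ℂ)) (fun p => stdAddChar_ne_zero _)
    (fun k₁ k₂ k₃ k₄ h => ?_) ?_
  · rw [← AddChar.map_add_eq_mul, ← AddChar.map_add_eq_mul, ← Pi.add_apply k₁.2, ← Pi.add_apply k₂.2, h.2]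
  · have hw : ∏ i, scalingWeight (fun p => (ZMod.stdAddChar (p.1.2 j) : ℂ)) (X i) =
        ZMod.stdAddChar (∑ i, (if (X i).2 = 0 then (1 : ℤ) else -1) • (X i).1.1.2 j) := by
      rw [addChar_map_sum]
      refine Finset.prod_congr rfl fun i _ => ?_
      rw [scalingWeight_eq_zpow, AddChar.map_zsmul_eq_zpow]
    rw [hw]
    intro h
    apply hX
    exact ZMod.injective_stdAddChar (h.trans (AddChar.map_zero_eq_one _).symm)

/-- At the incoming pair `((−ω,Q−k)↓−, (ω,k)↑−)` two outgoing line ends `ψ̂⁺_{pσ}ψ̂⁺_{p′σ′}` carry the kernel only if `p′ = p̄ = (−ω_p, Q − p⃗)`. -/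
theorem kernel_pp_eq_zero_of_ne_partner (Q k : TorusSite 2 L) (ω : MatsubaraIdx M) (p p' : FreqMomentum L M) (σ σ' : Fin 2)
    (h : p' ≠ (p.1.rev, Q - p.2)) :
    kernel ℂ W 4 ![((p, σ), 0), ((p', σ'), 0), (((ω.rev, Q - k), 1), 1), (((ω, k), 0), 1)] = 0 := by
  by_cases hf : p'.1 = p.1.rev
  · have hm : p'.2 ≠ Q - p.2 := fun h2 => h (Prod.ext hf h2)
    have : ∃ j : Fin 2, p'.2 j ≠ (Q - p.2) j := by
      by_contra hall
      push Not at hall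
      exact hm (funext hall)
    obtain ⟨j, hj⟩ := this
    refine kernel_eq_zero_of_momentum hW j ?_
    simp only [Fin.sum_univ_four, Matrix.cons_val_zero, Matrix.cons_val_one, Matrix.head_cons, Matrix.cons_val_two, Matrix.tail_cons,
      Matrix.cons_val_three, Fin.isValue, if_true, one_ne_zero, if_false, one_smul, neg_smul, Pi.sub_apply]
    intro h0
    apply hj
    rw [Pi.sub_apply]
    linear_combination h0
  · refine kernel_eq_zero_of_freq hW ?_
    simp only [Fin.sum_univ_four, Matrix.cons_val_zero, Matrix.cons_val_one, Matrix.head_cons, Matrix.cons_val_two, Matrix.tail_cons,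
      Matrix.cons_val_three, Fin.isValue, if_true, one_ne_zero, if_false, one_mul, neg_mul, matsubaraInt_rev]
    intro h0
    apply hf
    apply (matsubaraInt_add_eq_neg_one_iff p.1 p'.1).1
    linarith

/-- At the DIRECT particle–hole vertex `((ω′,k′)↑+, (ω,k)↑−)`: the line ends `ψ̂⁻_{pσ}, ψ̂⁺_{p′σ′}` force
`n(p′) = n(p) + n(ω) − n(ω′)`, `p⃗′ = p⃗ + k − k′`, `σ′ = σ`; stated for equal external frequencies `ω′ = ω`: `p′ = (ω_p, p⃗ + k − k′)`. -/
theorem kernel_phd_eq_zero_of_ne (k k' : TorusSite 2 L) (ω : MatsubaraIdx M) (p p' : FreqMomentum L M) (σ σ' : Fin 2)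
    (h : (p', σ') ≠ ((p.1, p.2 + k - k'), σ)) :
    kernel ℂ W 4 ![((p, σ), 1), ((p', σ'), 0), (((ω, k'), 0), 0), (((ω, k), 0), 1)] = 0 := by
  by_cases hσ : σ' = σ
  · subst hσ
    by_cases hf : p'.1 = p.1
    · have hm : p'.2 ≠ p.2 + k - k' := fun h2 => h (by rw [show p' = (p.1, p.2 + k - k') from Prod.ext hf h2])
      have : ∃ j : Fin 2, p'.2 j ≠ (p.2 + k - k') j := by
        by_contra hall
        push Not at hall
        exact hm (funext hall)
      obtain ⟨j, hj⟩ := this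
      refine kernel_eq_zero_of_momentum hW j ?_
      simp only [Fin.sum_univ_four, Matrix.cons_val_zero, Matrix.cons_val_one, Matrix.head_cons, Matrix.cons_val_two, Matrix.tail_cons,
        Matrix.cons_val_three, Fin.isValue, if_true, one_ne_zero, if_false, one_smul, neg_smul]
      intro h0
      apply hj
      rw [Pi.sub_apply, Pi.add_apply]
      linear_combination h0
    · refine kernel_eq_zero_of_freq hW ?_
      simp only [Fin.sum_univ_four, Matrix.cons_val_zero, Matrix.cons_val_one, Matrix.head_cons, Matrix.cons_val_two, Matrix.tail_cons,
        Matrix.cons_val_three, Fin.isValue, if_true, one_ne_zero, if_false, one_mul, neg_mul]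
      intro h0
      apply hf
      apply matsubaraInt_injective M
      linarith
  · refine kernel_eq_zero_of_spin hW ?_
    fin_cases σ <;> fin_cases σ' <;> first | exact absurd rfl hσ | simp [Fin.sum_univ_four]

/-- At the CROSSED particle–hole vertex `((ω₀,k′)↑+, (−ω₀,Q−k)↓−)` (lowest frequencies): the line ends `ψ̂⁻_{pσ}, ψ̂⁺_{p′σ′}` force
`n(ω_{p′}) + 1 = n(ω_p)`, `p⃗′ = p⃗ + Q − k − k′`, `(σ,σ′) = (↑,↓)`. -/
theorem kernel_phx_eq_zero_of_not [NeZero M] (Q k k' : TorusSite 2 L) (p p' : FreqMomentum L M) (σ σ' : Fin 2)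
    (h : ¬(matsubaraInt M p'.1 + 1 = matsubaraInt M p.1 ∧ p'.2 = p.2 + Q - k - k' ∧ σ = 0 ∧ σ' = 1)) :
    kernel ℂ W 4 ![((p, σ), 1), ((p', σ'), 0), (((omega0 M, k'), 0), 0), ((((omega0 M).rev, Q - k), 1), 1)] = 0 := by
  by_cases hs : σ = 0 ∧ σ' = 1
  · obtain ⟨rfl, rfl⟩ := hs
    by_cases hf : matsubaraInt M p'.1 + 1 = matsubaraInt M p.1
    · have hm : p'.2 ≠ p.2 + Q - k - k' := fun h2 => h ⟨hf, h2, rfl, rfl⟩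
      have : ∃ j : Fin 2, p'.2 j ≠ (p.2 + Q - k - k') j := by
        by_contra hall
        push Not at hall
        exact hm (funext hall)
      obtain ⟨j, hj⟩ := this
      refine kernel_eq_zero_of_momentum hW j ?_
      simp only [Fin.sum_univ_four, Matrix.cons_val_zero, Matrix.cons_val_one, Matrix.head_cons, Matrix.cons_val_two, Matrix.tail_cons,
        Matrix.cons_val_three, Fin.isValue, if_true, one_ne_zero, if_false, one_smul, neg_smul, Pi.sub_apply]
      intro h0
      apply hj
      rw [Pi.sub_apply, Pi.sub_apply, Pi.add_apply]
      linear_combination h0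
    · refine kernel_eq_zero_of_freq hW ?_
      simp only [Fin.sum_univ_four, Matrix.cons_val_zero, Matrix.cons_val_one, Matrix.head_cons, Matrix.cons_val_two, Matrix.tail_cons,
        Matrix.cons_val_three, Fin.isValue, if_true, one_ne_zero, if_false, one_mul, neg_mul, matsubaraInt_omega0, matsubaraInt_rev]
      intro h0
      apply hf
      linarith
  · refine kernel_eq_zero_of_spin hW ?_
    fin_cases σ <;> fin_cases σ' <;> first | exact absurd ⟨rfl, rfl⟩ hs | simp [Fin.sum_univ_four]

/-- Two-leg kernels of `W` pair only reciprocal labels (`ψ̂⁺` first). -/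
theorem kernel_two_plus_eq_zero (p : FreqMomentum L M) (σ : Fin 2) {Y' : HubbardFieldIdx L M} (hY : Y' ≠ ((p, σ), 1)) :
    kernel ℂ W 2 ![((p, σ), 0), Y'] = 0 := by
  rcases Y' with ⟨⟨p', σ'⟩, c'⟩
  by_cases hc : c' = 1
  · subst hc
    by_cases hσ : σ' = σ
    · subst hσ
      by_cases hf : p'.1 = p.1
      · have hm : p'.2 ≠ p.2 := fun h2 => hY (by rw [show p' = p from Prod.ext hf h2])
        have : ∃ j : Fin 2, p'.2 j ≠ p.2 j := by
          by_contra hall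
          push Not at hall
          exact hm (funext hall)
        obtain ⟨j, hj⟩ := this
        refine kernel_eq_zero_of_momentum hW j ?_
        simp only [Fin.sum_univ_two, Matrix.cons_val_zero, Matrix.cons_val_one, Fin.isValue, if_true, one_ne_zero, if_false,
          one_smul, neg_smul]
        intro h0
        apply hj
        linear_combination -h0
      · refine kernel_eq_zero_of_freq hW ?_
        simp only [Fin.sum_univ_two, Matrix.cons_val_zero, Matrix.cons_val_one, Fin.isValue, if_true, one_ne_zero, if_false,
          one_mul, neg_mul]
        intro h0
        apply hf
        apply matsubaraInt_injective M
        linarith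
    · refine kernel_eq_zero_of_spin hW ?_
      fin_cases σ <;> fin_cases σ' <;> first | exact absurd rfl hσ | simp [Fin.sum_univ_two]
  · obtain rfl : c' = 0 := by
      rcases Fin.exists_fin_two.mp ⟨c', rfl⟩ with h | h
      · exact h
      · exact absurd h hc
    refine kernel_eq_zero_of_charge hW ?_
    simp [Fin.sum_univ_two]

/-- … (`ψ̂⁻` first). -/
theorem kernel_two_minus_eq_zero (p : FreqMomentum L M) (σ : Fin 2) {Y' : HubbardFieldIdx L M} (hY : Y' ≠ ((p, σ), 0)) :
    kernel ℂ W 2 ![((p, σ), 1), Y'] = 0 := by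
  rcases Y' with ⟨⟨p', σ'⟩, c'⟩
  by_cases hc : c' = 0
  · subst hc
    have h2 : (![((p', σ'), (0 : Fin 2)), ((p, σ), 1)] : Fin 2 → HubbardFieldIdx L M) = ![((p, σ), 1), ((p', σ'), 0)] ∘ Equiv.swap (0 : Fin 2) 1 := by
      funext i; fin_cases i <;> rfl
    have h := kernel_two_plus_eq_zero hW p' σ' (Y' := ((p, σ), 1)) (fun h => hY (by
      simp only [Prod.mk.injEq] at h
      rw [h.1.1, h.1.2]))
    rw [h2, kernel_comp_perm, Equiv.Perm.sign_swap (by decide)] at h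
    simpa using h
  · obtain rfl : c' = 1 := by
      rcases Fin.exists_fin_two.mp ⟨c', rfl⟩ with h | h
      · exact absurd h hc
      · exact h
    refine kernel_eq_zero_of_charge hW ?_
    simp [Fin.sum_univ_two]

end Model

/-! ## §3 The grid carrier is an instance -/

/-- **`𝒲_n = klWickAction … n` is scaling-invariant** (p495253 `map_scaling_klWickAction`), so every lemma of this file applies to it. -/
theorem klWickAction_scalingInvariant (L M : ℕ) [NeZero L] [NeZero M] (β U μ : ℝ) (K : TrigPolyC4v) (n : ℕ) :
    ∀ φ : FreqMomentum L M × Fin 2 → ℂ, (∀ p, φ p ≠ 0) →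
      (∀ k₁ k₂ k₃ k₄ : FreqMomentum L M,
        matsubaraInt M k₁.1 + matsubaraInt M k₃.1 = matsubaraInt M k₂.1 + matsubaraInt M k₄.1 ∧ k₁.2 + k₃.2 = k₂.2 + k₄.2 →
          φ (k₁, 0) * φ (k₃, 1) = φ (k₂, 0) * φ (k₄, 1)) →
      ExteriorAlgebra.map (LinearMap.mulLeft ℂ (scalingWeight φ)) (klWickAction L M β U μ K n) = klWickAction L M β U μ K n :=
  fun φ hφ hV => map_scaling_klWickAction φ hφ hV β U μ K n

end Summit.HubbardSuperconductivity.HubbardSuperconductivity.Theorems.KLRegimeWickAbs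

end
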